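import Summits.AnomalousDissipation.AnomalousDissipation.Theses.StirringSphere
import Literature.Analysis.FluidPDE.StatisticalSolutionDirac
import Literature.Analysis.FluidPDE.StatisticalSolutionProofs

/-!
# Negative knowledge for the crux `StirringSphere.NoScreening` (stmt-AnomalousDissipation-17144):
# load-bearing stationarity, redundant integrability (certified copy of `Cruxes/NoScreening/Disproof.lean` §1–§2)

Refuter-first crux attack (`refuter-rattack-stmt-AnomalousDissipation-17144-0`, 2026-08-17, one cycle).
VERDICT: the crux SURVIVES the cheap attacks; no Lean kill is available (a counterexample is a bounded,
QUIET (`injection → 0`) Foias–Prodi statistics of `NS_ν(f_c)` along `ν → 0`, i.e. an actual construction of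
stationary statistical solutions of 3-D Navier–Stokes — out of reach, and its existence is itself open).
Nothing in this file asserts a Theses statement; everything is sorry-free.

Findings (details in the item evidence `ATTACK-NoScreening.md`):

* §1 `noScreening_false_without_stationarity` — the Foias–Prodi STATIONARITY hypothesis is load-bearing and
  the conclusion is not junk-true: with `IsStationaryStatisticalSolution ν f_c μ` weakened to
  `IsProbabilityMeasure μ`, the Dirac mass `δ₀` (energy `0 ≤ E`, `‖·‖²` integrable) has mean-flow response
  `y(δ₀) = 0`, so the statement fails for every `m₀ > 0`.  (At fixed `ν > 0` no stationary statistics is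
  screened: `c·y(μ) = ∫(f_c,u)dμ ≥ ν·⟨enstrophy⟩` by `energy_le_holds`, and `⟨enstrophy⟩ = 0` forces
  `μ = δ₀`, which violates the Liouville identity tested on `Φ'(u) = f_c` since `‖f_c‖₂² = 3/2 ≠ 0`.)
* §2 `noScreening_iff_noInt` — the hypothesis `Integrable (fun u => ‖u‖²) μ` is REDUNDANT (hypothesis
  mutation): it follows from the finite-mean-enstrophy clause of `IsStationaryStatisticalSolution` by the
  spectral Poincaré inequality on `H` (`integrable_norm_sq_of_enstrophy_lt_top`, a private copy of the tree's
  `GPStatisticalRigidity.Negative.integrable_norm_sq_of_ensembleEnstrophy_lt_top`).  Provers may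
  assume it for free; refuters gain nothing by violating it.
* §3 (recorded, not formalised — needs the isometry action of `T³` on `H`, absent from the tree)
  SYMMETRIC-POINT REDUCTION: at the six forces `c ∈ {(±1,±1,0)/√2, ±e₂}` of the sphere the stabiliser
  `G_c ≤ Isom(T³)` of `f_c` (order 24, signed permutations ∘ quarter-translations; computed in
  `symcheck.py`, attached) averages `(b₀,b₁,b₂)` INTO `ℝ·f_c` (e.g. at the ABC point `c* = (e₀+e₁)/√2`,
  `f_{c*} = ABC(1,1,1)/√2`: `avg_G g·b₀ = avg_G g·b₁ = (b₀+b₁)/2`, `avg_G g·b₂ = 0`).  Since the Foias–Prodi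
  class of `NS_ν(f_c)` is convex and `G_c`-invariant with `y` linear and energy `G_c`-invariant, the
  `G_c`-average `μ̄` of any bounded statistics `μ` is bounded with `y(μ̄) = P(μ)·c`, `P(μ) = ∫(f_c,u)dμ` the
  injected power.  HENCE `NoScreening ⟹ ν-UNIFORM INJECTION FLOOR at each symmetric force`:
  `∀ E ∃ ν₀ m₀ > 0 ∀ ν < ν₀ ∀ μ` bounded Foias–Prodi statistics of `NS_ν(f_{c*})`: `∫(f_{c*},u)dμ ≥ m₀` —
  a universal (all-statistics) zeroth-law-type floor for the ABC(1,1,1), its mirror image and the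
  second-shell force `b₂`; conversely such a floor gives `|y| ≥ c·y = P ≥ m₀` there.  So at symmetric forces
  the crux is EXACTLY an injection floor (the "turbulence may rotate y" slack vanishes); the route's hairy-ball
  mechanism buys nothing at those points.  Not a refutation (the floor is open, not known false).
* §4 (paper) VACUITY PROFILE: for `E < E_* ≈ ‖f_c‖₂²/‖∇f_c‖_∞` and small `ν` the hypothesis class is EMPTY
  (Liouville identity on `Φ'(u) = f_c`: `3/2 = ‖f_c‖² ≤ ν‖Δf_c‖₂√E + ‖∇f_c‖_∞E`), so the crux is vacuously
  true at small energy levels — intended (only large `E` matter).  NON-VACUITY at moderate `ν`: at the four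
  Beltrami points `(±1,±1,0)/√2` the laminar state `f_c/(4π²ν)` is an exact steady state and its Dirac mass a
  stationary statistical solution of energy `3/(32π⁴ν²)` (tree: `EnsembleCeiling.Negative.not_ceiling_abc`,
  `exists_fat_stationary_of_singleShell_eulerSteady`), inside the class iff `ν ≥ √(3/(32π⁴E))`, with
  `|y| = 3/(8π²ν)` — large, harmless to the crux; whether ANY bounded statistics exists for `ν → 0` is the
  sibling crux `BoundedSphereStatistics` (open).
-/

noncomputable section

set_option linter.dupNamespace false

namespace Summit.AnomalousDissipation.AnomalousDissipation.Theorems.NoScreening.Negative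

open MeasureTheory
open scoped InnerProductSpace RealInnerProductSpace ENNReal
open Literature.Analysis.FunctionSpaces Literature.Analysis.FluidPDE
open Summit.AnomalousDissipation.AnomalousDissipation.Theses.StirringSphere

/-! ## §1 Stationarity is load-bearing (witness `δ₀`) -/

/-- The crux `NoScreening` with the Foias–Prodi stationarity hypothesis
`IsStationaryStatisticalSolution ν f_c μ` WEAKENED to `IsProbabilityMeasure μ` (everything else verbatim). -/
def NoScreeningWithoutStationarity : Prop :=
  ∀ b : Fin 3 → UnitAddTorus (Fin 3) → EuclideanSpace ℝ (Fin 3), b = ![(fun x : UnitAddTorus (Fin 3) => (Literature.Analysis.FluidPDE.Torus.stokesMode (Pi.single (2 : Fin 3) (1 : ℤ)) (EuclideanSpace.single (0 : Fin 3) (1 : ℝ)) false x + Literature.Analysis.FluidPDE.Torus.stokesMode (Pi.single (0 : Fin 3) (1 : ℤ)) (EuclideanSpace.single (1 : Fin 3) (1 : ℝ)) false x + Literature.Analysis.FluidPDE.Torus.stokesMode (Pi.single (1 : Fin 3) (1 : ℤ)) (EuclideanSpace.single (2 : Fin 3) (1 : ℝ)) false x : EuclideanSpace ℝ (Fin 3))),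 (fun x : UnitAddTorus (Fin 3) => (Literature.Analysis.FluidPDE.Torus.stokesMode (Pi.single (1 : Fin 3) (1 : ℤ)) (EuclideanSpace.single (0 : Fin 3) (1 : ℝ)) true x + Literature.Analysis.FluidPDE.Torus.stokesMode (Pi.single (2 : Fin 3) (1 : ℤ)) (EuclideanSpace.single (1 : Fin 3) (1 : ℝ)) true x + Literature.Analysis.FluidPDE.Torus.stokesMode (Pi.single (0 : Fin 3) (1 : ℤ)) (EuclideanSpace.single (2 : Fin 3) (1 : ℝ)) true x : EuclideanSpace ℝ (Fin 3))), (fun x : UnitAddTorus (Fin 3) => (Literature.Analysis.FluidPDE.Torus.stokesMode ![(0 : ℤ), 1, 1] (EuclideanSpace.single (0 : Fin 3) (1 : ℝ)) false x + Literature.Analysis.FluidPDE.Torus.stokesMode ![(1 : ℤ), 0, 1] (EuclideanSpace.single (1 : Fin 3) (1 : ℝ)) false x + Literature.Analysis.FluidPDE.Torus.stokesMode ![(1 : ℤ), 1, 0] (EuclideanSpace.single (2 : Fin 3) (1 : ℝ)) false x : EuclideanSpace ℝ (Fin 3)))] → ∀ E : ℝ, 0 < E → ∃ ν₀ m₀ :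 ℝ, 0 < ν₀ ∧ 0 < m₀ ∧ ∀ c : EuclideanSpace ℝ (Fin 3), ‖c‖ = 1 → ∀ ν : ℝ, 0 < ν → ν < ν₀ → ∀ μ : MeasureTheory.Measure (Literature.Analysis.FunctionSpaces.Torus.energySpace (Fin 3)), MeasureTheory.IsProbabilityMeasure μ → MeasureTheory.Integrable (fun u : Literature.Analysis.FunctionSpaces.Torus.energySpace (Fin 3) => ‖u‖ ^ 2) μ → Literature.Analysis.FluidPDE.Torus.ensembleEnergy μ ≤ E → m₀ ^ 2 ≤ ∑ i : Fin 3, (∫ u, Literature.Analysis.FluidPDE.Torus.pairing (u : MeasureTheory.Lp (EuclideanSpace ℝ (Fin 3)) 2 (MeasureTheory.volume : MeasureTheory.Measure (UnitAddTorus (Fin 3)))) (b i) ∂μ) ^ 2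

/-- The response integrals of the Dirac mass at `0 ∈ H` vanish: `∫ (u, g) dδ₀(u) = (0, g) = 0`. -/
theorem integral_pairing_dirac_zero (g : UnitAddTorus (Fin 3) → EuclideanSpace ℝ (Fin 3)) :
    ∫ u, Torus.pairing ((u : Torus.energySpace (Fin 3)) :
        Lp (EuclideanSpace ℝ (Fin 3)) 2 (volume : Measure (UnitAddTorus (Fin 3)))) g
      ∂(Measure.dirac (0 : Torus.energySpace (Fin 3))) = 0 := by
  haveI : MeasurableSingletonClass (Torus.energySpace (Fin 3)) :=
    OpensMeasurableSpace.toMeasurableSingletonClass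
  rw [integral_dirac]
  show Torus.pairing ((0 : Torus.energySpace (Fin 3)) :
      Lp (EuclideanSpace ℝ (Fin 3)) 2 (volume : Measure (UnitAddTorus (Fin 3)))) g = 0
  rw [Submodule.coe_zero]
  unfold Torus.pairing
  refine integral_eq_zero_of_ae ?_
  filter_upwards [Lp.coeFn_zero (EuclideanSpace ℝ (Fin 3)) 2 (volume : Measure (UnitAddTorus (Fin 3)))]
    with x hx
  rw [hx]
  simp

/-- The mean energy of `δ₀` is `0`. -/
theorem ensembleEnergy_dirac_zero :
    Torus.ensembleEnergy (Measure.dirac (0 : Torus.energySpace (Fin 3))) = 0 := by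
  haveI : MeasurableSingletonClass (Torus.energySpace (Fin 3)) :=
    OpensMeasurableSpace.toMeasurableSingletonClass
  unfold Torus.ensembleEnergy
  rw [integral_dirac]
  simp

/-- **Stationarity is load-bearing.** Without the Foias–Prodi conditions the probability measure `δ₀`
(energy `0`, response `y = 0`) defeats every floor `m₀ > 0`: any proof of `NoScreening` must use the
Navier–Stokes dynamics (Liouville identity / energy inequality), not only normalisation and the energy
bound. -/
theorem noScreening_false_without_stationarity : ¬ NoScreeningWithoutStationarity := by
  intro h
  obtain ⟨ν₀, m₀, hν₀, hm₀, H⟩ := h _ rfl 1 one_pos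
  have hc : ‖EuclideanSpace.single (0 : Fin 3) (1 : ℝ)‖ = 1 := by simp
  have key := H _ hc (ν₀ / 2) (by positivity) (by linarith) (Measure.dirac 0) inferInstance
    (Torus.integrable_dirac _ _) (by rw [ensembleEnergy_dirac_zero]; norm_num)
  simp only [integral_pairing_dirac_zero] at key
  have : (0 : ℝ) < m₀ ^ 2 := by positivity
  norm_num at key
  linarith

/-! ## §2 The energy-integrability hypothesis is redundant -/

/-- **Finite mean enstrophy forces integrable energy** on `H` (Poincaré `‖v‖² ≤ ‖∇v‖²` plus measurability
of the spectral enstrophy density).  Private copy of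
`Theorems.GPStatisticalRigidity.Negative.integrable_norm_sq_of_ensembleEnstrophy_lt_top` (that survivor is
importable only together with the route file `Theses.EnsembleRigidity`, which must stay out of this file's
import closure). -/
private theorem integrable_norm_sq_of_enstrophy_lt_top
    (μ : Measure (Torus.energySpace (Fin 3))) [IsFiniteMeasure μ] (hG : Torus.ensembleEnstrophy μ < ⊤) :
    Integrable (fun v : Torus.energySpace (Fin 3) => ‖v‖ ^ 2) μ := by
  have hmeas := (Torus.measurable_eGradNormSq_coe (d := Fin 3))
  have hint : Integrable (fun v : Torus.energySpace (Fin 3) =>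
      (Torus.eGradNormSq ((v : Lp (EuclideanSpace ℝ (Fin 3)) 2 (volume : Measure (UnitAddTorus (Fin 3)))) :
        UnitAddTorus (Fin 3) → EuclideanSpace ℝ (Fin 3))).toReal) μ :=
    integrable_toReal_of_lintegral_ne_top hmeas.aemeasurable hG.ne
  refine hint.mono' ((continuous_norm.pow 2).aestronglyMeasurable) ?_
  filter_upwards [ae_lt_top hmeas hG.ne] with v hv
  rw [Real.norm_of_nonneg (by positivity)]
  have hP := Torus.enorm_sq_le_eGradNormSq v
  calc ‖v‖ ^ 2 = (‖v‖ₑ ^ 2).toReal := by rw [ENNReal.toReal_pow, toReal_enorm]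
    _ ≤ _ := ENNReal.toReal_mono hv.ne hP

/-- The crux `NoScreening` with the hypothesis `Integrable (fun u => ‖u‖ ^ 2) μ` DELETED. -/
def NoScreeningNoInt : Prop :=
  ∀ b : Fin 3 → UnitAddTorus (Fin 3) → EuclideanSpace ℝ (Fin 3), b = ![(fun x : UnitAddTorus (Fin 3) => (Literature.Analysis.FluidPDE.Torus.stokesMode (Pi.single (2 : Fin 3) (1 : ℤ)) (EuclideanSpace.single (0 : Fin 3) (1 : ℝ)) false x + Literature.Analysis.FluidPDE.Torus.stokesMode (Pi.single (0 : Fin 3) (1 : ℤ)) (EuclideanSpace.single (1 : Fin 3) (1 : ℝ)) false x + Literature.Analysis.FluidPDE.Torus.stokesMode (Pi.single (1 : Fin 3) (1 : ℤ)) (EuclideanSpace.single (2 : Fin 3) (1 : ℝ)) false x : EuclideanSpace ℝ (Fin 3))), (fun x : UnitAddTorus (Fin 3) => (Literature.Analysis.FluidPDE.Torus.stokesMode (Pi.single (1 : Fin 3) (1 : ℤ)) (EuclideanSpace.single (0 : Fin 3) (1 : ℝ)) true x + Literature.Analysis.FluidPDE.Torus.stokesMode (Pi.single (2 : Fin 3)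 (1 : ℤ)) (EuclideanSpace.single (1 : Fin 3) (1 : ℝ)) true x + Literature.Analysis.FluidPDE.Torus.stokesMode (Pi.single (0 : Fin 3) (1 : ℤ)) (EuclideanSpace.single (2 : Fin 3) (1 : ℝ)) true x : EuclideanSpace ℝ (Fin 3))), (fun x : UnitAddTorus (Fin 3) => (Literature.Analysis.FluidPDE.Torus.stokesMode ![(0 : ℤ), 1, 1] (EuclideanSpace.single (0 : Fin 3) (1 : ℝ)) false x + Literature.Analysis.FluidPDE.Torus.stokesMode ![(1 : ℤ), 0, 1] (EuclideanSpace.single (1 : Fin 3) (1 : ℝ)) false x + Literature.Analysis.FluidPDE.Torus.stokesMode ![(1 : ℤ), 1, 0] (EuclideanSpace.single (2 : Fin 3) (1 : ℝ)) false x : EuclideanSpace ℝ (Fin 3)))] → ∀ E : ℝ, 0 < E → ∃ ν₀ m₀ : ℝ, 0 < ν₀ ∧ 0 < m₀ ∧ ∀ c : EuclideanSpace ℝ (Fin 3), ‖c‖ = 1 → ∀ ν : ℝ, 0 < ν → ν < ν₀ → ∀ μ : MeasureTheory.Measure (Literature.Analysis.FunctionSpaces.Torus.energySpace (Fin 3)),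 Literature.Analysis.FluidPDE.Torus.IsStationaryStatisticalSolution ν (fun x : UnitAddTorus (Fin 3) => ∑ i : Fin 3, c i • b i x) μ → Literature.Analysis.FluidPDE.Torus.ensembleEnergy μ ≤ E → m₀ ^ 2 ≤ ∑ i : Fin 3, (∫ u, Literature.Analysis.FluidPDE.Torus.pairing (u : MeasureTheory.Lp (EuclideanSpace ℝ (Fin 3)) 2 (MeasureTheory.volume : MeasureTheory.Measure (UnitAddTorus (Fin 3)))) (b i) ∂μ) ^ 2

/-- **`Integrable ‖u‖²` is redundant**: deleting it gives an equivalent statement, because a stationary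
statistical solution is a probability measure of finite mean enstrophy and `‖u‖² ≤ ‖∇u‖²` on `H`
(`integrable_norm_sq_of_enstrophy_lt_top`). -/
theorem noScreening_iff_noInt : NoScreening ↔ NoScreeningNoInt := by
  constructor
  · intro h b hb E hE
    obtain ⟨ν₀, m₀, hν₀, hm₀, H⟩ := h b hb E hE
    refine ⟨ν₀, m₀, hν₀, hm₀, fun c hc ν hν hνlt μ hμ hEμ => H c hc ν hν hνlt μ hμ ?_ hEμ⟩
    haveI := hμ.prob
    exact integrable_norm_sq_of_enstrophy_lt_top μ hμ.enstrophy_finite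
  · intro h b hb E hE
    obtain ⟨ν₀, m₀, hν₀, hm₀, H⟩ := h b hb E hE
    exact ⟨ν₀, m₀, hν₀, hm₀, fun c hc ν hν hνlt μ hμ _ hEμ => H c hc ν hν hνlt μ hμ hEμ⟩

end Summit.AnomalousDissipation.AnomalousDissipation.Theorems.NoScreening.Negative

end
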